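import Mathlib

/-!
# Crux idea `coincidence-dichotomy` — structured-side rung: `VerticesOfMonomialImage` (val-idea-8 g0)

Kernel-checked form of the first structured-side lemma of `Cruxes/TwoProducts/Ideas/coincidence-dichotomy.md`:
the planar Newton polygon of a MONOMIAL IMAGE has no more vertices than the `d`-dimensional Newton polytope upstairs,
because every extreme point of a linear image of a polytope is the image of an extreme point (the fibre over an extreme
point is a face; Krein–Milman gives it an extreme point; faces inherit extremality).  Statement VERBATIM the Sketch's
`VerticesOfMonomialImage` (same `emb2`, `embD`).  Honest frame: a standard convexity lemma, recorded so the structured side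
of the dichotomy starts from a theorem; 5906 OPEN; VP ≠ VNP not proved, not moved.
-/

set_option linter.dupNamespace false

namespace Summit.ValiantsHypothesis.ValiantsHypothesis.Cruxes.TwoProducts.CoincidenceDichotomy

open scoped BigOperators

/-- real embedding of planar exponents -/
noncomputable def emb2 (e : Fin 2 →₀ ℕ) : Fin 2 → ℝ := fun i => ((e i : ℕ) : ℝ)
/-- real embedding of `d`-dimensional exponents -/
noncomputable def embD {d : ℕ} (e : Fin d →₀ ℕ) : Fin d → ℝ := fun i => ((e i : ℕ) : ℝ)

/-- STRUCTURED SIDE, first lemma: the planar Newton polygon of a monomial image has no more vertices than the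
`d`-dimensional Newton polytope upstairs. -/
def VerticesOfMonomialImage : Prop :=
  ∀ (d : ℕ) (φ : (Fin d →₀ ℕ) →+ (Fin 2 →₀ ℕ)) (S : Finset (Fin d →₀ ℕ)),
    (Set.extremePoints ℝ (convexHull ℝ (emb2 '' (φ '' (↑S : Set (Fin d →₀ ℕ)))))).ncard ≤
      (Set.extremePoints ℝ (convexHull ℝ (embD '' (↑S : Set (Fin d →₀ ℕ))))).ncard

/-- The linear map `x ↦ Σ_i x_i • c_i`. -/
noncomputable def linExt {d : ℕ} (c : Fin d → (Fin 2 → ℝ)) : (Fin d → ℝ) →ₗ[ℝ] (Fin 2 → ℝ) where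
  toFun x := ∑ i, x i • c i
  map_add' x y := by
    simp only [Pi.add_apply, add_smul, Finset.sum_add_distrib]
  map_smul' r x := by
    simp only [Pi.smul_apply, smul_eq_mul, RingHom.id_apply, Finset.smul_sum, smul_smul]

theorem linExt_apply {d : ℕ} (c : Fin d → (Fin 2 → ℝ)) (x : Fin d → ℝ) :
    linExt c x = ∑ i, x i • c i := rfl

/-- **Extreme points of a linear image of a polytope are images of extreme points** (counting form):
for a finite set `A` and a linear map `ψ`, `#ext(conv(ψ '' A)) ≤ #ext(conv A)`. -/
theorem ncard_extremePoints_image_le {d : ℕ} (ψ : (Fin d → ℝ) →ₗ[ℝ] (Fin 2 → ℝ))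
    (A : Set (Fin d → ℝ)) (hA : A.Finite) :
    (Set.extremePoints ℝ (convexHull ℝ (ψ '' A))).ncard ≤
      (Set.extremePoints ℝ (convexHull ℝ A)).ncard := by
  classical
  have hface : ∀ e ∈ Set.extremePoints ℝ (convexHull ℝ (ψ '' A)),
      ∃ x ∈ Set.extremePoints ℝ (convexHull ℝ A), ψ x = e := by
    intro e he
    have heA : e ∈ ψ '' A := extremePoints_convexHull_subset he
    obtain ⟨a, haA, hae⟩ := heA
    have hExt : IsExtreme ℝ (convexHull ℝ A) (convexHull ℝ A ∩ ψ ⁻¹' {e}) := by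
      refine ⟨Set.inter_subset_left, ?_⟩
      intro x₁ hx₁ x₂ hx₂ x hx hseg
      have hx1K : ψ x₁ ∈ convexHull ℝ (ψ '' A) := by
        rw [← LinearMap.image_convexHull]; exact ⟨x₁, hx₁, rfl⟩
      have hx2K : ψ x₂ ∈ convexHull ℝ (ψ '' A) := by
        rw [← LinearMap.image_convexHull]; exact ⟨x₂, hx₂, rfl⟩
      have hψx : ψ x = e := by
        have := hx.2
        simpa [Set.mem_preimage] using this
      have him : (ψ : (Fin d → ℝ) → (Fin 2 → ℝ)) '' openSegment ℝ x₁ x₂ = openSegment ℝ (ψ x₁) (ψ x₂) := by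
        simpa using image_openSegment ℝ ψ.toAffineMap x₁ x₂
      have hsegim : ψ x ∈ openSegment ℝ (ψ x₁) (ψ x₂) := by
        rw [← him]; exact ⟨x, hseg, rfl⟩
      rw [hψx] at hsegim
      obtain ⟨h1, -⟩ := (mem_extremePoints.mp he).2 _ hx1K _ hx2K hsegim
      exact Set.mem_inter hx₁ (by simpa [Set.mem_preimage] using h1)
    have hKc : IsCompact (convexHull ℝ A) := Set.Finite.isCompact_convexHull ℝ hA
    have hFc : IsCompact (convexHull ℝ A ∩ ψ ⁻¹' {e}) :=
      hKc.inter_right (isClosed_singleton.preimage ψ.continuous_of_finiteDimensional)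
    have hFne : (convexHull ℝ A ∩ ψ ⁻¹' {e}).Nonempty :=
      ⟨a, Set.mem_inter (subset_convexHull ℝ A haA) (by simp [hae])⟩
    obtain ⟨x, hx⟩ := hFc.extremePoints_nonempty hFne
    refine ⟨x, hExt.extremePoints_subset_extremePoints hx, ?_⟩
    have hxFe : x ∈ convexHull ℝ A ∩ ψ ⁻¹' {e} := hx.1
    simpa [Set.mem_preimage] using hxFe.2
  choose! sel hsel using hface
  have hfin : (Set.extremePoints ℝ (convexHull ℝ A)).Finite := hA.subset extremePoints_convexHull_subset
  refine Set.ncard_le_ncard_of_injOn sel (fun e he => (hsel e he).1) ?_ hfin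
  intro e₁ he₁ e₂ he₂ h
  rw [← (hsel e₁ he₁).2, ← (hsel e₂ he₂).2, h]

/-- `emb2` of an `ℕ`-linear combination. -/
theorem emb2_sum_nsmul {d : ℕ} (n : Fin d → ℕ) (x : Fin d → (Fin 2 →₀ ℕ)) :
    emb2 (∑ i, n i • x i) = ∑ i, ((n i : ℕ) : ℝ) • emb2 (x i) := by
  funext k
  simp [emb2, Finset.sum_apply, Pi.smul_apply]

/-- The monomial image is a linear image upstairs: `emb2 (φ e) = linExt c (embD e)` with `c i = emb2 (φ eᵢ)`. -/
theorem emb2_map_eq_linExt {d : ℕ} (φ : (Fin d →₀ ℕ) →+ (Fin 2 →₀ ℕ)) (e : Fin d →₀ ℕ) :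
    emb2 (φ e) = linExt (fun i => emb2 (φ (Finsupp.single i 1))) (embD e) := by
  have he : e = ∑ i, (e i) • Finsupp.single i 1 := by
    conv_lhs => rw [← Finsupp.univ_sum_single e]
    refine Finset.sum_congr rfl fun i _ => ?_
    rw [Finsupp.smul_single_one]
  rw [linExt_apply]
  conv_lhs => rw [he]
  rw [map_sum]
  have : (∑ i, φ (e i • Finsupp.single i 1)) = ∑ i, (e i) • φ (Finsupp.single i 1) := by
    refine Finset.sum_congr rfl fun i _ => ?_
    rw [map_nsmul]
  rw [this, emb2_sum_nsmul]
  rfl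

/-- **`VerticesOfMonomialImage` holds.** -/
theorem verticesOfMonomialImage : VerticesOfMonomialImage := by
  intro d φ S
  classical
  set ψ := linExt (fun i => emb2 (φ (Finsupp.single i 1))) with hψ
  have himg : emb2 '' (φ '' (↑S : Set (Fin d →₀ ℕ))) = ψ '' (embD '' (↑S : Set (Fin d →₀ ℕ))) := by
    rw [Set.image_image, Set.image_image]
    refine Set.image_congr fun e _ => ?_
    simpa [hψ] using emb2_map_eq_linExt φ e
  rw [himg]
  exact ncard_extremePoints_image_le ψ _ ((S.finite_toSet).image _)

end Summit.ValiantsHypothesis.ValiantsHypothesis.Cruxes.TwoProducts.CoincidenceDichotomy
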